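import Mathlib
import Summits.Ventures.PercRepro2.Defs
import Summits.Ventures.PercRepro2.Graph
import Summits.Ventures.PercRepro2.Induced
import Summits.Ventures.PercRepro2.VdBKahn
import Summits.Ventures.PercRepro2.ReimerVdBK
import Summits.Ventures.PercRepro2.ReimerVdBKTwisted
import Summits.Ventures.PercRepro2.ReimerVdBKTied
import Summits.Ventures.PercRepro2.ReimerVdBKCoreDown
import Summits.Ventures.PercRepro2.ReimerVdBKDegTwoCalc
import Summits.Ventures.PercRepro2.ReimerVdBKOuter
import Summits.Ventures.PercRepro2.ReimerVdBKPatch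
import Summits.Ventures.PercRepro2.ReimerVdBKOuterStars
import Summits.Ventures.PercRepro2.ReimerVdBKCellEdges

/-!
# The cell theorem: at `N = ∅` the pairing of a revealed set is decided cell by cell by the inner colouring
(blind cell PercRepro2, mine-c g50; `conjectures/MINE-C.md` §59.0, `proofs/MINEC-CELL.md` — part II; part I
`ReimerVdBKCellEdges`: the edges at a vertex set, monotonicity off loops, the closure lemma in outer-star form;
part III `ReimerVdBKCellCoin`: the one coin for an adjacent `X`–`Y` pair)

A CELL of a revealed set `R` is a pattern `d` on ALL the edges at `R` (`edgesTouching ends R`: the outer stars AND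
the inner edges), i.e. the sub-cube `onF (edgesTouching ends R) d`.  The theorem of `ReimerVdBKOuterOneWorld`
pairs the sub-cube of an outer pattern with the sub-cube of the pattern with the stars of `R ∩ X` flipped;
here the pairing may depend on the inner colouring through two FORCED sets: `FX` = revealed vertices that the
left event forces outside the world-1 cluster on the cell (the `X`-vertices of `R` and whatever is joined to
them by red inner edges), `FY` = those forced outside the world-2 cluster (the `Y`-vertices and whatever is
joined to them by blue inner edges).  For every `T` with `R ∖ FY ⊆ T ⊆ FX`, the left count on the cell of
`d` is at most the right count on the cell of a pattern `d'` that flips the outer stars of `T`, keeps those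
of `R ∖ T`, and on the inner edges dominates `d` off `FX` and `compl d` off `FY` (`count_cell_le`).  The
three steps are those of `ReimerVdBKOuterOneWorld`: on the cell the left event is `U₁ ∩ bar U₂` for two
upper sets of the free cube, with the inertness normal forms taken at the forced sets
(`preimage_twoWorld_eq_cell`); Harris; and `U₁ ∩ U₂` lies in the right event on the target cell
(`cellUpOne_inter_cellUpTwo_subset`) — world 1 by monotonicity off loops (`conn_mono_offLoops`), world 2 by
the closure lemma in its outer-star form (`conn_iff_of_closed_outer`: agreement is needed only on the
edges leaving the closed vertex set, which is why inner edges between the revealed vertices may be coloured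
at will on the target).  `T = R ∩ X`, `FX = R ∩ X`, `FY = R ∖ X` (no forcing through inner edges) is the
pairing of `ReimerVdBKOuterOneWorld`.
-/

namespace Summit.Ventures.PercRepro2
namespace ReimerVdBK
open Classical

variable {V : Type*} {E : Type*} [Fintype E] [DecidableEq E] [Fintype V] [DecidableEq V]

/-! ## The two upper sets of a cell -/

section Main
variable (ends : E → Sym2 V) (s : V) (A X B Y R FX FY : Finset V)

/-- The upper event `U₁(d)` of the cell of `d` on the free cube: `A` connected in world 1 with the edges at
`FX` closed, `FY` avoided in world 2, `Y ∖ R` avoided in world 2 with the edges at `FY` closed. -/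
def cellUpOne (d : Config E) : Set (Config {e : E // e ∉ edgesTouching ends R}) :=
  patch (edgesTouching ends R) (setOn (edgesTouching ends FX) false d) ⁻¹' connAll ends s A ∩
    patch (edgesTouching ends R) d ⁻¹' bar (avoidAll ends s FY) ∩
    patch (edgesTouching ends R) (setOn (edgesTouching ends FY) true d) ⁻¹' bar (avoidAll ends s (Y \ R))

/-- The upper event `U₂(d)` of the cell of `d` (the `bar` of the lower part of the left event): `FX` avoided
in world 1, `X ∖ R` avoided in world 1 with the edges at `FX` closed, `B` connected in world 2 with the edges
at `FY` closed — each read on the complemented free configuration. -/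
def cellUpTwo (d : Config E) : Set (Config {e : E // e ∉ edgesTouching ends R}) :=
  patch (edgesTouching ends R) (compl d) ⁻¹' bar (avoidAll ends s FX) ∩
    patch (edgesTouching ends R) (compl (setOn (edgesTouching ends FX) false d)) ⁻¹' bar (avoidAll ends s (X \ R)) ∩
    patch (edgesTouching ends R) (compl (setOn (edgesTouching ends FY) true d)) ⁻¹' connAll ends s B

omit [Fintype V] in
/-- `U₁(d)` is an upper set. -/
lemma isUpperSet_cellUpOne (d : Config E) : IsUpperSet (cellUpOne ends s A Y R FX FY d) := by
  refine IsUpperSet.inter (IsUpperSet.inter ?_ ?_) ?_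
  · exact (isUpperSet_connAll ends s A).preimage (patch_mono _ _)
  · exact (isUpperSet_bar_of_isLowerSet (isLowerSet_avoidAll ends s _)).preimage (patch_mono _ _)
  · exact (isUpperSet_bar_of_isLowerSet (isLowerSet_avoidAll ends s _)).preimage (patch_mono _ _)

omit [Fintype V] in
/-- `U₂(d)` is an upper set. -/
lemma isUpperSet_cellUpTwo (d : Config E) : IsUpperSet (cellUpTwo ends s X B R FX FY d) := by
  refine IsUpperSet.inter (IsUpperSet.inter ?_ ?_) ?_
  · exact (isUpperSet_bar_of_isLowerSet (isLowerSet_avoidAll ends s _)).preimage (patch_mono _ _)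
  · exact (isUpperSet_bar_of_isLowerSet (isLowerSet_avoidAll ends s _)).preimage (patch_mono _ _)
  · exact (isUpperSet_connAll ends s B).preimage (patch_mono _ _)

omit [Fintype V] in
/-- **The left event on a cell is `U₁(d) ∩ bar U₂(d)`**, provided the cell forces `FX` outside the world-1
cluster and `FY` outside the world-2 cluster of every left colouring, with `R ∩ X ⊆ FX` and `R ∩ Y ⊆ FY`. -/
lemma preimage_twoWorld_eq_cell (hRX : R ∩ X ⊆ FX) (hRY : R ∩ Y ⊆ FY)
    (d : Config E)
    (hFX : ∀ ω' : Config {e : E // e ∉ edgesTouching ends R}, patch (edgesTouching ends R) d ω' ∈ twoWorld ends s A X B Y →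
      ∀ w ∈ FX, ¬ Conn ends (patch (edgesTouching ends R) d ω') s w)
    (hFY : ∀ ω' : Config {e : E // e ∉ edgesTouching ends R}, patch (edgesTouching ends R) d ω' ∈ twoWorld ends s A X B Y →
      ∀ w ∈ FY, ¬ Conn ends (compl (patch (edgesTouching ends R) d ω')) s w) :
    patch (edgesTouching ends R) d ⁻¹' twoWorld ends s A X B Y =
      cellUpOne ends s A Y R FX FY d ∩ bar (cellUpTwo ends s X B R FX FY d) := by
  ext ω'
  have hL := hFX ω'
  have hL' := hFY ω'
  simp only [Set.mem_preimage, twoWorld, Set.mem_inter_iff, mem_bar, cellUpOne, cellUpTwo, connAll,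
    avoidAll, Set.mem_setOf_eq, compl_patch, compl_compl] at hL hL' ⊢
  -- the two inertness equivalences
  have hin1 : (∀ w ∈ FX, ¬ Conn ends (patch (edgesTouching ends R) d ω') s w) → ∀ u,
      Conn ends (patch (edgesTouching ends R) d ω') s u ↔
        Conn ends (patch (edgesTouching ends R) (setOn (edgesTouching ends FX) false d) ω') s u :=
    fun hav u => conn_iff_of_avoid ends s FX (patch_setOn_le ends R FX d ω')
      (fun e he => patch_setOn_agree ends R FX d ω' e he) hav u
  have hin2 : (∀ w ∈ FY, ¬ Conn ends (patch (edgesTouching ends R) (compl d) (compl ω')) s w) → ∀ u,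
      Conn ends (patch (edgesTouching ends R) (compl d) (compl ω')) s u ↔
        Conn ends (patch (edgesTouching ends R) (compl (setOn (edgesTouching ends FY) true d)) (compl ω')) s u :=
    fun hav u => conn_iff_of_avoid ends s FY (patch_compl_setOn_le ends R FY d (compl ω'))
      (fun e he => patch_compl_setOn_agree ends R FY d (compl ω') e he) hav u
  constructor
  · rintro ⟨⟨hA, hX⟩, hB, hY⟩
    have hav1 : ∀ w ∈ FX, ¬ Conn ends (patch (edgesTouching ends R) d ω') s w := hL ⟨⟨hA, hX⟩, hB, hY⟩
    have hav2 : ∀ w ∈ FY, ¬ Conn ends (patch (edgesTouching ends R) (compl d) (compl ω')) s w :=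
      hL' ⟨⟨hA, hX⟩, hB, hY⟩
    refine ⟨⟨⟨fun a ha => (hin1 hav1 a).1 (hA a ha), hav2⟩, fun y hy => ?_⟩,
      ⟨hav1, fun x hx => ?_⟩, fun b hb => (hin2 hav2 b).1 (hB b hb)⟩
    · exact fun h => hY y (Finset.mem_sdiff.1 hy).1 ((hin2 hav2 y).2 h)
    · exact fun h => hX x (Finset.mem_sdiff.1 hx).1 ((hin1 hav1 x).2 h)
  · rintro ⟨⟨⟨hA, hav2⟩, hY'⟩, ⟨hav1, hX'⟩, hB⟩
    refine ⟨⟨fun a ha => (hin1 hav1 a).2 (hA a ha), fun x hx => ?_⟩,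
      fun b hb => (hin2 hav2 b).2 (hB b hb), fun y hy => ?_⟩
    · by_cases hxR : x ∈ R
      · exact hav1 x (hRX (Finset.mem_inter.2 ⟨hxR, hx⟩))
      · exact fun h => hX' x (Finset.mem_sdiff.2 ⟨hx, hxR⟩) ((hin1 hav1 x).1 h)
    · by_cases hyR : y ∈ R
      · exact hav2 y (hRY (Finset.mem_inter.2 ⟨hyR, hy⟩))
      · exact fun h => hY' y (Finset.mem_sdiff.2 ⟨hy, hyR⟩) ((hin2 hav2 y).1 h)

/-- **`U₁(d) ∩ U₂(d)` lies in the right event on the target cell** of a pattern `d'` that flips the outer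
stars of `T` (`R ∖ FY ⊆ T ⊆ FX`), keeps those of `R ∖ T`, and on the non-loop edges at `R` dominates `d` off
`FX` and `compl d` off `FY`. -/
lemma cellUpOne_inter_cellUpTwo_subset (T : Finset V) (hT : T ⊆ FX)
    (hT' : R \ FY ⊆ T) (d d' : Config E)
    (hd1 : ∀ e ∈ edgesTouching ends R, ¬ (ends e).IsDiag → (∀ w ∈ FX, w ∉ ends e) → d e ≤ d' e)
    (hd2 : ∀ e ∈ edgesTouching ends R, ¬ (ends e).IsDiag → (∀ w ∈ FY, w ∉ ends e) → (!d e) ≤ d' e)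
    (hd3 : ∀ w ∈ T, ∀ e ∈ outerStar ends R w, d' e = !d e)
    (hd4 : ∀ w ∈ R \ T, ∀ e ∈ outerStar ends R w, d' e = d e) :
    cellUpOne ends s A Y R FX FY d ∩ cellUpTwo ends s X B R FX FY d ⊆
      patch (edgesTouching ends R) d' ⁻¹' twoWorld ends s (A ∪ B) ∅ ∅ (X ∪ Y) := by
  rintro ω'' ⟨⟨⟨hA, hFY'⟩, hY'⟩, ⟨hFX', hX'⟩, hB⟩
  simp only [Set.mem_preimage, mem_bar, connAll, avoidAll, Set.mem_setOf_eq, compl_patch, compl_compl]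
    at hA hFY' hY' hFX' hX' hB
  simp only [Set.mem_preimage, twoWorld, Set.mem_inter_iff, mem_bar, connAll, avoidAll, Set.mem_setOf_eq,
    compl_patch, Finset.notMem_empty, IsEmpty.forall_iff, implies_true, true_and, and_true]
  -- the world-2 configuration of the target and its all-closed minorant
  set η := patch (edgesTouching ends R) (compl d') (compl ω'') with hη
  set η₀ := patch (edgesTouching ends R) (setOn (edgesTouching ends R) false (compl d')) (compl ω'') with hη₀
  have hmin : ∀ d₁ : Config E, η₀ ≤ patch (edgesTouching ends R) d₁ (compl ω'') := by
    intro d₁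
    refine patch_le_patch _ (fun e he => ?_) _
    rw [setOn_of_mem _ he]
    exact Bool.false_le _
  have hle : η₀ ≤ η := hmin _
  have hoff : ∀ e, (∀ w ∈ R, w ∉ ends e) → η₀ e = η e := by
    intro e he
    have hF : e ∉ edgesTouching ends R := not_mem_edgesAt_of_not_incident ends he
    rw [hη, hη₀, patch_of_not_mem _ hF, patch_of_not_mem _ hF]
  have hW : ∀ w ∈ R, ∃ ηw : Config E, η₀ ≤ ηw ∧
      (∀ e, w ∈ ends e → (∃ x ∈ ends e, x ∉ R) → ηw e = η e) ∧ ¬ Conn ends ηw s w := by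
    intro w hw
    by_cases hwT : w ∈ T
    · refine ⟨patch (edgesTouching ends R) d (compl ω''), hmin d, ?_, hFX' w (hT hwT)⟩
      intro e hwe hx
      obtain ⟨x, hxe, hxR⟩ := hx
      have hF : e ∈ edgesTouching ends R := (mem_edgesAt_iff ends).2 ⟨w, hw, hwe⟩
      have hne : w ≠ x := fun h => hxR (h ▸ hw)
      have hstar : e ∈ outerStar ends R w :=
        (mem_outerStar_iff ends).2 ⟨x, (Sym2.mem_and_mem_iff hne).1 ⟨hwe, hxe⟩, hxR⟩
      rw [hη, patch_of_mem _ hF, patch_of_mem _ hF]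
      simp only [compl]
      rw [hd3 w hwT e hstar, Bool.not_not]
    · refine ⟨patch (edgesTouching ends R) (compl d) (compl ω''), hmin _, ?_, ?_⟩
      · intro e hwe hx
        obtain ⟨x, hxe, hxR⟩ := hx
        have hF : e ∈ edgesTouching ends R := (mem_edgesAt_iff ends).2 ⟨w, hw, hwe⟩
        have hne : w ≠ x := fun h => hxR (h ▸ hw)
        have hstar : e ∈ outerStar ends R w :=
          (mem_outerStar_iff ends).2 ⟨x, (Sym2.mem_and_mem_iff hne).1 ⟨hwe, hxe⟩, hxR⟩
        rw [hη, patch_of_mem _ hF, patch_of_mem _ hF]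
        simp only [compl]
        rw [hd4 w (Finset.mem_sdiff.2 ⟨hw, hwT⟩) e hstar]
      · have hwFY : w ∈ FY := by
          by_contra hn
          exact hwT (hT' (Finset.mem_sdiff.2 ⟨hw, hn⟩))
        exact hFY' w hwFY
  have hcl := conn_iff_of_closed_outer ends s R hle hoff hW
  refine ⟨fun a ha => ?_, fun y hy => ?_⟩
  · -- world 1: `A ∪ B` connected under the target pattern
    rcases Finset.mem_union.1 ha with haA | haB
    · refine conn_mono_offLoops ends (fun e hnd => ?_) (hA a haA)
      by_cases hF : e ∈ edgesTouching ends R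
      · rw [patch_of_mem _ hF, patch_of_mem _ hF]
        by_cases he : e ∈ edgesTouching ends FX
        · rw [setOn_of_mem _ he]
          exact Bool.false_le _
        · rw [setOn_of_not_mem _ he]
          exact hd1 e hF hnd (fun w hw hwe => he ((mem_edgesAt_iff ends).2 ⟨w, hw, hwe⟩))
      · rw [patch_of_not_mem _ hF, patch_of_not_mem _ hF]
    · refine conn_mono_offLoops ends (fun e hnd => ?_) (hB a haB)
      by_cases hF : e ∈ edgesTouching ends R
      · rw [patch_of_mem _ hF, patch_of_mem _ hF, compl_setOn]
        by_cases he : e ∈ edgesTouching ends FY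
        · rw [setOn_of_mem _ he]
          exact Bool.false_le _
        · rw [setOn_of_not_mem _ he]
          exact hd2 e hF hnd (fun w hw hwe => he ((mem_edgesAt_iff ends).2 ⟨w, hw, hwe⟩))
      · rw [patch_of_not_mem _ hF, patch_of_not_mem _ hF]
  · -- world 2: `X ∪ Y` avoided under the target pattern
    intro hcon
    have h0 : Conn ends η₀ s y := (hcl y).1 hcon
    by_cases hyR : y ∈ R
    · by_cases hyT : y ∈ T
      · exact hFX' y (hT hyT) (conn_mono (hmin d) h0)
      · have hyFY : y ∈ FY := by
          by_contra hn
          exact hyT (hT' (Finset.mem_sdiff.2 ⟨hyR, hn⟩))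
        exact hFY' y hyFY (conn_mono (hmin (compl d)) h0)
    · rcases Finset.mem_union.1 hy with hyX | hyY
      · exact hX' y (Finset.mem_sdiff.2 ⟨hyX, hyR⟩) (conn_mono (hmin _) h0)
      · exact hY' y (Finset.mem_sdiff.2 ⟨hyY, hyR⟩) (conn_mono (hmin _) h0)

/-- **The cell theorem** (`MINE-C.md` §59.0): under the forcing hypotheses of `preimage_twoWorld_eq_cell` and
the target hypotheses of `cellUpOne_inter_cellUpTwo_subset`, the left count on the cell of `d` is at most
the right count on the cell of `d'` — Harris on the free cube between the two upper sets. -/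
theorem count_cell_le (hRX : R ∩ X ⊆ FX) (hRY : R ∩ Y ⊆ FY)
    (T : Finset V) (hT : T ⊆ FX) (hT' : R \ FY ⊆ T) (d d' : Config E)
    (hFX : ∀ ω' : Config {e : E // e ∉ edgesTouching ends R}, patch (edgesTouching ends R) d ω' ∈ twoWorld ends s A X B Y →
      ∀ w ∈ FX, ¬ Conn ends (patch (edgesTouching ends R) d ω') s w)
    (hFY : ∀ ω' : Config {e : E // e ∉ edgesTouching ends R}, patch (edgesTouching ends R) d ω' ∈ twoWorld ends s A X B Y →
      ∀ w ∈ FY, ¬ Conn ends (compl (patch (edgesTouching ends R) d ω')) s w)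
    (hd1 : ∀ e ∈ edgesTouching ends R, ¬ (ends e).IsDiag → (∀ w ∈ FX, w ∉ ends e) → d e ≤ d' e)
    (hd2 : ∀ e ∈ edgesTouching ends R, ¬ (ends e).IsDiag → (∀ w ∈ FY, w ∉ ends e) → (!d e) ≤ d' e)
    (hd3 : ∀ w ∈ T, ∀ e ∈ outerStar ends R w, d' e = !d e)
    (hd4 : ∀ w ∈ R \ T, ∀ e ∈ outerStar ends R w, d' e = d e) :
    count (twoWorld ends s A X B Y ∩ onF (edgesTouching ends R) d) ≤
      count (twoWorld ends s (A ∪ B) ∅ ∅ (X ∪ Y) ∩ onF (edgesTouching ends R) d') := by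
  rw [count_inter_onF_eq, count_inter_onF_eq,
    preimage_twoWorld_eq_cell ends s A X B Y R FX FY hRX hRY d hFX hFY]
  calc count (cellUpOne ends s A Y R FX FY d ∩ bar (cellUpTwo ends s X B R FX FY d))
      ≤ count (cellUpOne ends s A Y R FX FY d ∩ cellUpTwo ends s X B R FX FY d) :=
        count_inter_bar_le_count_inter (isUpperSet_cellUpOne ends s A Y R FX FY d)
          (isUpperSet_cellUpTwo ends s X B R FX FY d)
    _ ≤ count (patch (edgesTouching ends R) d' ⁻¹' twoWorld ends s (A ∪ B) ∅ ∅ (X ∪ Y)) :=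
        count_mono (cellUpOne_inter_cellUpTwo_subset ends s A X B Y R FX FY T hT hT' d d'
          hd1 hd2 hd3 hd4)

end Main

end ReimerVdBK
end Summit.Ventures.PercRepro2
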